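import Mathlib
import Literature.NumberTheory.LFunctions.DirichletLFunctionZeroFreeRegion
import Literature.NumberTheory.LFunctions.SiegelExceptionalZeroBound
import Literature.NumberTheory.LFunctions.ZetaZeroFreeRegion
import Literature.NumberTheory.LFunctions.ZetaLogDerivDisc

/-!
# (Z1) Small conductors are box-zero-free

Crux `stmt-Parity-14271` (`DilatedTableChowla`), line *positivity-quarantine*, stub
`stub_smallConductors`: for all real `K, K', H` there is `x₀` such that for `x ≥ x₀` no Dirichlet
`L`-function to a modulus `d ≤ (log x)^K` vanishes in the Linnik box
`re s > 1 − K' log log x / log x`, `|im s| ≤ (log x)^H`, `s ≠ 1`.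

Proof (classical). Write `L = log x`, `ℓ = log L`. For `d ≤ L^K` and `|t| ≤ L^H` one has
`log d + log(|t| + 4) ≤ (max(K,1) + max(H,1) + 2) ℓ`, so the de la Vallée-Poussin–Gronwall–Landau
region `σ > 1 − c/(log d + log(|t| + 4))` of Montgomery–Vaughan Theorem 11.3
(`Literature.NumberTheory.LFunctions.DirichletZFR.exists_zeroFree`, all non-principal `χ`) and the
classical region of `ζ` (`Literature.NumberTheory.LFunctions.classicalZFRData_riemannZeta`, for the
principal character via `DirichletCharacter.LFunctionTrivChar_eq_mul_riemannZeta`) have width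
`≫ 1/ℓ`, much wider than `K' ℓ / L` for large `L`; the only possible zeros left are real zeros of
quadratic characters, which Siegel's theorem
(`Literature.NumberTheory.LFunctions.Siegel.exists_one_sub_realZero_ge`, MV Corollary 11.15, with
`ε = 1/(2 max(K,1))`) keeps at distance `≥ C d^{-ε} ≥ C L^{-1/2} ≫ K' ℓ / L` from `1`.

References: H. L. Montgomery, R. C. Vaughan, *Multiplicative Number Theory I*, CUP 2007,
Theorem 11.3, Corollary 11.15, Theorem 6.6.
-/

open Filter Asymptotics

namespace Summit.Parity.GeneralizedHardyLittlewood.Theorems.DilatedTableChowla.SmallConductors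

/-- From `f = o(g)` at `+∞`: for `a, b > 0`, eventually `a f(x) ≤ b |g(x)|`. [folklore] -/
theorem eventually_mul_le_mul_abs_of_isLittleO {f g : ℝ → ℝ} (h : f =o[atTop] g) {a b : ℝ}
    (ha : 0 < a) (hb : 0 < b) : ∀ᶠ x in atTop, a * f x ≤ b * |g x| := by
  filter_upwards [h.bound (div_pos hb ha)] with x hx
  rw [Real.norm_eq_abs, Real.norm_eq_abs] at hx
  calc a * f x ≤ a * |f x| := by gcongr; exact le_abs_self _
    _ ≤ a * (b / a * |g x|) := by gcongr
    _ = b * |g x| := by field_simp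

/-- The growth conditions on `L = log x` used below: eventually `L ≥ 3`, `log L ≥ 1`,
`2A log L ≤ L`, `A B (log L)² ≤ c L` and `A log L ≤ C L^{1/2}` (`A, B, C, c > 0`), from
`log L = o(L)`, `(log L)² = o(L)`, `log L = o(L^{1/2})`. [folklore] -/
theorem eventually_growth {A B C c : ℝ} (hA : 0 < A) (hB : 0 < B) (hC : 0 < C) (hc : 0 < c) :
    ∀ᶠ L : ℝ in atTop, 3 ≤ L ∧ 1 ≤ Real.log L ∧ 2 * A * Real.log L ≤ L ∧
      A * B * Real.log L ^ 2 ≤ c * L ∧ A * Real.log L ≤ C * L ^ (1 / 2 : ℝ) := by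
  have h1 : ∀ᶠ L : ℝ in atTop, 3 ≤ L := eventually_ge_atTop 3
  have h2 : ∀ᶠ L : ℝ in atTop, 1 ≤ Real.log L := Real.tendsto_log_atTop.eventually_ge_atTop 1
  have h3 := eventually_mul_le_mul_abs_of_isLittleO Real.isLittleO_log_id_atTop
    (a := 2 * A) (b := 1) (by positivity) one_pos
  have h4 := eventually_mul_le_mul_abs_of_isLittleO (Real.isLittleO_pow_log_id_atTop (n := 2))
    (a := A * B) (b := c) (by positivity) hc
  have h5 := eventually_mul_le_mul_abs_of_isLittleO
    (isLittleO_log_rpow_atTop (by norm_num : (0 : ℝ) < 1 / 2)) (a := A) (b := C) hA hC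
  filter_upwards [h1, h2, h3, h4, h5] with L h1 h2 h3 h4 h5
  have hL : 0 ≤ L := by linarith
  refine ⟨h1, h2, ?_, ?_, ?_⟩
  · simpa [abs_of_nonneg hL] using h3
  · simpa [abs_of_nonneg hL] using h4
  · simpa [abs_of_nonneg (Real.rpow_nonneg hL _)] using h5

/-- For `re s > 0` the Euler factors `1 − p^{-s}` (`p` prime) do not vanish, since
`|p^{-s}| = p^{-re s} < 1`. [folklore] -/
theorem prod_one_sub_cpow_ne_zero (d : ℕ) {s : ℂ} (hs : 0 < s.re) :
    ∏ p ∈ d.primeFactors, (1 - (p : ℂ) ^ (-s)) ≠ 0 := by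
  refine Finset.prod_ne_zero_iff.mpr fun p hp ↦ ?_
  have hp2 : 2 ≤ p := (Nat.prime_of_mem_primeFactors hp).two_le
  rw [sub_ne_zero]
  intro h
  have hnorm : ‖(p : ℂ) ^ (-s)‖ = (p : ℝ) ^ (-s.re) := by
    rw [Complex.norm_natCast_cpow_of_pos (by omega)]
    simp
  have hlt : (p : ℝ) ^ (-s.re) < 1 :=
    Real.rpow_lt_one_of_one_lt_of_neg (by exact_mod_cast hp2) (by linarith)
  rw [← h, norm_one] at hnorm
  linarith

/-- The principal character: `L(χ₀ mod d, s) = ∏_{p ∣ d} (1 − p^{-s}) · ζ(s) ≠ 0` whenever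
`s ≠ 1`, `re s > 0` and `ζ(s) ≠ 0` (Mathlib's
`DirichletCharacter.LFunctionTrivChar_eq_mul_riemannZeta`). [folklore] -/
theorem LFunction_one_ne_zero_of_riemannZeta_ne_zero (d : ℕ) [NeZero d] {s : ℂ} (hs1 : s ≠ 1)
    (hre : 0 < s.re) (hζ : riemannZeta s ≠ 0) : (1 : DirichletCharacter ℂ d).LFunction s ≠ 0 := by
  change DirichletCharacter.LFunctionTrivChar d s ≠ 0
  rw [DirichletCharacter.LFunctionTrivChar_eq_mul_riemannZeta hs1]
  exact mul_ne_zero (prod_one_sub_cpow_ne_zero d hre) hζ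

/-- **(Z1) Small conductors are box-zero-free.** For all real `K, K', H` there is `x₀` such that
for `x ≥ x₀`, every modulus `d ≤ (log x)^K`, every Dirichlet character `χ` mod `d` and every
`s ≠ 1` with `re s > 1 − K' log log x / log x`, `|im s| ≤ (log x)^H`: `L(s, χ) ≠ 0`.
Classical: the zero-free region of Montgomery–Vaughan Theorem 11.3
(`Literature.NumberTheory.LFunctions.DirichletZFR.exists_zeroFree`), the classical region for `ζ`
(`Literature.NumberTheory.LFunctions.classicalZFRData_riemannZeta`, MV Theorem 6.6) and Siegel's
theorem for real zeros (`Literature.NumberTheory.LFunctions.Siegel.exists_one_sub_realZero_ge`,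
MV Corollary 11.15) are all wider than the box once `x` is large.
[cite: MontgomeryVaughan2007, Theorem 11.3 and Corollary 11.15] -/
theorem stub_smallConductors :
    ∀ K K' H : ℝ, ∃ x₀ : ℝ, ∀ x : ℝ, x₀ ≤ x →
      ∀ (d : ℕ) [NeZero d] (χ : DirichletCharacter ℂ d) (s : ℂ), (d : ℝ) ≤ Real.log x ^ K →
        1 - K' * Real.log (Real.log x) / Real.log x < s.re → |s.im| ≤ Real.log x ^ H → s ≠ 1 →
          DirichletCharacter.LFunction χ s ≠ 0 := by
  intro K K' H
  obtain ⟨c, hc, hzf⟩ := Literature.NumberTheory.LFunctions.DirichletZFR.exists_zeroFree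
  obtain ⟨cζ, hcζ, hζ⟩ :=
    Literature.NumberTheory.LFunctions.classicalZFRData_riemannZeta.zeroFree
  set Kp : ℝ := max K 1 with hKp
  set Hp : ℝ := max H 1 with hHp
  set A : ℝ := max K' 1 with hA
  have hKp1 : 1 ≤ Kp := le_max_right _ _
  have hHp1 : 1 ≤ Hp := le_max_right _ _
  have hA1 : 1 ≤ A := le_max_right _ _
  have hε : 0 < 1 / (2 * Kp) := by positivity
  obtain ⟨C, hC, hS⟩ :=
    Literature.NumberTheory.LFunctions.Siegel.exists_one_sub_realZero_ge hε
  set B : ℝ := Kp + Hp + 2 with hB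
  set c₀ : ℝ := min c cζ with hc₀
  have hc₀c : c₀ ≤ c := min_le_left _ _
  have hc₀ζ : c₀ ≤ cζ := min_le_right _ _
  have hc₀pos : 0 < c₀ := lt_min hc hcζ
  have hev := Real.tendsto_log_atTop.eventually
    (eventually_growth (A := A) (B := B) (C := C) (c := c₀) (by positivity) (by positivity) hC
      hc₀pos)
  obtain ⟨x₀, hx₀⟩ := Filter.eventually_atTop.1 hev
  refine ⟨x₀, fun x hx d inst χ s hd hre him hs1 hzero ↦ ?_⟩
  obtain ⟨hL3, hlogL, hE3, hE4, hE5⟩ := hx₀ x hx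
  set L : ℝ := Real.log x with hLdef
  have hL0 : 0 < L := by linarith
  have hL1 : 1 ≤ L := by linarith
  set ℓ : ℝ := Real.log L with hℓdef
  have hℓ0 : 0 < ℓ := by linarith
  -- the enlarged width `w = A ℓ / L ≥ K' ℓ / L`, `w ≤ 1/2`
  set w : ℝ := A * ℓ / L with hwdef
  have hw : 1 - w < s.re := by
    have : K' * ℓ / L ≤ w :=
      div_le_div_of_nonneg_right (mul_le_mul_of_nonneg_right (le_max_left _ _) hℓ0.le) hL0.le
    linarith
  have hwhalf : w ≤ 1 / 2 := by
    rw [hwdef, div_le_iff₀ hL0]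
    linarith
  have hre12 : 1 / 2 < s.re := by linarith
  -- `log(|t| + 4) ≤ (Hp + 2) ℓ`
  have ht0 : 0 < Real.log (|s.im| + 4) := Real.log_pos (by linarith [abs_nonneg s.im])
  have ht : Real.log (|s.im| + 4) ≤ (Hp + 2) * ℓ := by
    have h1 : |s.im| ≤ L ^ Hp := him.trans (Real.rpow_le_rpow_of_exponent_le hL1 (le_max_left _ _))
    have h2 : |s.im| + 4 ≤ L ^ (Hp + 2) := by
      rw [Real.rpow_add hL0, Real.rpow_two]
      have h3 : 1 ≤ L ^ Hp := Real.one_le_rpow hL1 (by linarith)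
      have h4 : 9 ≤ L ^ 2 := by nlinarith
      have h5 : L ^ Hp * 9 ≤ L ^ Hp * L ^ 2 := mul_le_mul_of_nonneg_left h4 (by positivity)
      linarith
    calc Real.log (|s.im| + 4) ≤ Real.log (L ^ (Hp + 2)) := Real.log_le_log (by positivity) h2
      _ = (Hp + 2) * ℓ := Real.log_rpow hL0 _
  -- `log d ≤ Kp ℓ`
  have hdpos : (0 : ℝ) < d := Nat.cast_pos.mpr (Nat.pos_of_neZero d)
  have hdK : (d : ℝ) ≤ L ^ Kp := hd.trans (Real.rpow_le_rpow_of_exponent_le hL1 (le_max_left _ _))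
  have hlogd0 : 0 ≤ Real.log (d : ℝ) := Real.log_natCast_nonneg d
  have hlogd : Real.log d ≤ Kp * ℓ := by
    calc Real.log d ≤ Real.log (L ^ Kp) := Real.log_le_log hdpos hdK
      _ = Kp * ℓ := Real.log_rpow hL0 _
  -- `w (log d + log(|t| + 4)) ≤ A B ℓ² / L ≤ c₀`
  have hden : Real.log d + Real.log (|s.im| + 4) ≤ B * ℓ := by
    rw [hB]
    linarith
  have hwc : w * (Real.log d + Real.log (|s.im| + 4)) ≤ c₀ := by
    calc w * (Real.log d + Real.log (|s.im| + 4)) ≤ w * (B * ℓ) := by gcongr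
      _ = A * B * ℓ ^ 2 / L := by rw [hwdef]; ring
      _ ≤ c₀ := by rw [div_le_iff₀ hL0]; exact hE4
  by_cases hχ : χ = 1
  · -- the principal character: `ζ(s) ≠ 0` in the classical region
    subst hχ
    refine LFunction_one_ne_zero_of_riemannZeta_ne_zero d hs1 (by linarith) (fun h ↦ ?_) hzero
    have hwζ : w ≤ cζ / Real.log (|s.im| + 4) := by
      rw [le_div_iff₀ ht0]
      nlinarith
    exact hζ s (by linarith) (by linarith)
      ((Literature.NumberTheory.LFunctions.riemannZeta₁_eq_zero_iff hs1).mpr h)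
  · -- non-principal: the zero is real and `χ` is quadratic (MV Theorem 11.3) ...
    have hreg : 1 - c / (Real.log d + Real.log (|s.im| + 4)) < s.re := by
      have : w ≤ c / (Real.log d + Real.log (|s.im| + 4)) := by
        rw [le_div_iff₀ (by positivity)]
        linarith
      linarith
    obtain ⟨hχ2, him0⟩ := hzf d χ hχ s hzero hreg
    have hs : s = (s.re : ℂ) := Complex.ext (by simp) (by simp [him0])
    have hzero' : χ.LFunction (s.re : ℂ) = 0 := by rw [← hs]; exact hzero
    -- ... and Siegel's theorem keeps real zeros away from `1`
    have hSiegel := hS d χ hχ2 hχ s.re hzero'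
    have h1 : C * (L ^ Kp) ^ (-(1 / (2 * Kp))) ≤ C * (d : ℝ) ^ (-(1 / (2 * Kp))) :=
      mul_le_mul_of_nonneg_left
        (Real.rpow_le_rpow_of_nonpos hdpos hdK (neg_nonpos.mpr hε.le)) hC.le
    have h2 : (L ^ Kp) ^ (-(1 / (2 * Kp))) = L ^ (-(1 / 2 : ℝ)) := by
      rw [← Real.rpow_mul hL0.le]
      congr 1
      field_simp
    have h3 : L ^ (-(1 / 2 : ℝ)) * L = L ^ (1 / 2 : ℝ) := by
      conv_lhs => rw [show L ^ (-(1 / 2 : ℝ)) * L = L ^ (-(1 / 2 : ℝ)) * L ^ (1 : ℝ) by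
        rw [Real.rpow_one]]
      rw [← Real.rpow_add hL0]
      norm_num
    have h4 : C * L ^ (-(1 / 2 : ℝ)) < A * ℓ / L := by
      calc C * L ^ (-(1 / 2 : ℝ)) = C * (L ^ Kp) ^ (-(1 / (2 * Kp))) := by rw [h2]
        _ ≤ C * (d : ℝ) ^ (-(1 / (2 * Kp))) := h1
        _ ≤ 1 - s.re := hSiegel
        _ < w := by linarith
        _ = A * ℓ / L := hwdef
    rw [lt_div_iff₀ hL0, mul_assoc, h3] at h4
    linarith

end Summit.Parity.GeneralizedHardyLittlewood.Theorems.DilatedTableChowla.SmallConductors
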